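import Mathlib
import HarnessLib
import HarnessLib.Audit
import Summits.AtomisticToContinuum.Statement
import Literature.Analysis.FluidPDE.HardSphereFlowConstruction

/-!
Route: RandomFutureLindeberg

CLOSED (retired) 2026-08-15T13:45:47Z by operator:999:1257524 — reason: not-a-thesis: assembly does not conclude the sub-problem Statement — note: D-0027 §2.1 audit (human 2026-08-15: routes that do not decide the summit are removed): the assembly concludes `Literature.MathematicalPhysics.KineticTheory.HydrodynamicLimit`, not the sub-problem statement; a NEW conforming route may be opened from the same idea (generated `closes : … → _root_.Hydr. The file is kept as the record of this route; refuted decls are indexed as negative knowledge (`ledger negatives`).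

# Route RandomFutureLindeberg — Lindeberg slabs with the random-scattering gas in the future —
deterministic slab closure in mean, stochastic screening transfer

It suffices to show X = X_I ∧ X_T ∧ LambertianEuler (card lindeberg-random-future-universality,
"Lindeberg hybrids with the random gas in
the FUTURE"; the comparison node SwapGap and the random-model theorem LambertianEuler are the SAME
ledger items as in route
SpecularLambertianSwap — this route is the card's ALTERNATIVE decomposition of SwapGap, which that
route declares it does not realise).
X_I (DETERMINISTIC SLAB CLOSURE IN MEAN, cruxes SlabMomentumClosure + SlabEnergyClosure): along the
deterministic hard-sphere flow started
from a local Gibbs law, pre-shock, the increment over a kinetic slab [s, s + τ(N+1)^(-1/3)] of the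
empirical momentum (resp. energy) field
tested against a smooth χ equals the slab length times the LOCAL-EQUILIBRIUM Euler flux ((u·∇χ)ρu +
p∇χ, resp. (E+p)u·∇χ, p = ρθZ(ρσ³))
of the block conserved fields of the time-s configuration at any mesoscopic scale Kn ≪ ℓ_N ≪ 1, in
L¹ of the law, uniformly in s ≤ T' < T,
with relative error δ(τ) → 0 as τ → ∞ after N → ∞. X_T (RANDOM-FUTURE TRANSFER, crux
RandomFutureTransfer): X_I ⇒ SwapGap, i.e. the laws
of the tested fields under the deterministic flow and under the Lambertian gas Λ (same free flight
and contacts, cosine-law outgoing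
direction, pair momentum/energy conserved) merge — proved by time-slab Lindeberg–Trotter hybrids
with Λ in the FUTURE, so that every
response estimate (kinetic screening [S], slab relaxation of Λ) is a property of the STOCHASTIC gas
and the deterministic gas is asked only
for X_I. With LambertianEuler (Euler for Λ, OVY/FFL class) the conjunct follows by portmanteau.
Lean: `SlabMomentumClosure ∧ SlabEnergyClosure ∧ RandomFutureTransfer ∧ LambertianEuler`

## Assembly
Portmanteau plumbing, provable now and IDENTICAL in content to route SpecularLambertianSwap's
Assembly (SwapGap → LambertianEuler →
HydrodynamicLimit; the two shared decls have verbatim the same bodies, so either assembly follows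
from the other by unfolding — checked in
Sketch.lean as `assembly_of_sls`): fix profiles, σ₀ := min of the σ₀'s of the four hypotheses; for σ
< σ₀, a classical solution on [0,T),
flows Φ, the t = 0 hypothesis and t < T, χ, δ: RandomFutureTransfer applied to cruxes 2–3 gives
SwapGap; with the 1-Lipschitz bounded
F = min(1, (|d − ∫χρ_t| − δ/2)₊ ∧ δ/2) one has min(1,δ/2)·P_N(δ < |density field(Φ_t z) − ∫χρ_t|) ≤
∫F∘fields∘Φ_t dP_N =
∫F∘fields∘Λ_t d(P_N⊗γ^ℕ) + o(1) ≤ (P_N⊗γ^ℕ)(δ/2 < |density field(Λ_t) − ∫χρ_t|) + o(1) → 0 by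
LambertianEuler; likewise momentum and
energy: TendstoHydroFieldsAt at every t < T, i.e. HydrodynamicLimitFor σ for σ < σ₀(profiles), hence
the conjunct (hydrodynamicLimit_iff).

Rationale: WHY THIS LINE. Lindeberg's replacement scheme (Chatterjee2006) and the consistency–stability
telescoping of Kac's program (MischlerMouhot2012) are run
between two N-body hard-sphere gases on the same phase space with the same collision invariants,
Gibbs states and equation of state:
E_HS(1) G(fields_t) − E_HS(0) G(fields_t) = Σ_k E_(f_s_k)[Ψ_k(det-slab z) − Ψ_k(rand-slab z)], Ψ_k
the HS(0) value function, so the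
deterministic gas enters only through ONE kinetic slab from its own time-s law. Kinetic screening in
HS(0) makes the non-conserved channel
cost O(Kn)·(t/τ slabs) → 0 with no deterministic relaxation at all; the conserved channel is exactly
X_I, a statement about MEANS over finitely
many mean free times (Spohn1991 Part I §3.1–3.2: propagation of local equilibrium, "deep and highly
non-obvious"; the microscopic currents
(3.6)–(3.8)). Imported areas: probability (Lindeberg–Trotter swapping, Markov semigroup comparison),
conservative-noise hydrodynamic limits
(OllaVaradhanYau1993, FritzFunakiLebowitz1994, LiveraniOlla1996) for the HS(0) side. Unlike
VanishingNoise (noise intensity γ_N → 0 and a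
stochastic-stability crux) and angular-noise-ladder option (U) (p_N → 1), the endpoints are FIXED (p
= 0 vs p = 1): nothing vanishes, no
pathwise or law-level stability of the deterministic gas is ever invoked; unlike
RelEntropyErgodic/ChaoticMixing no invariant-measure
classification of the deterministic dynamics is used. Versus SpecularLambertianSwap (same
architecture in contact/Duhamel form): the OPPOSITE crux allocation — there the stochastic gas is
asked MORE (per-collision linear response uniform over deterministically evolved states, Volterra
closure) and the deterministic gas LESS
(one-curve W1-equidistribution of contact normals); here the deterministic input is slab closure in
MEAN (X_I, the board's open core, typed
HS(0)-free and reusable — it is also the typed content of DissipativeWeakStrong's informal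
FluxClosure) and the stochastic input is kinetic
screening; the refuter audit of both cards found that neither allocation dominates.

RANKED CRUXES. #0 SwapGap (target) — [shared node = route SpecularLambertianSwap's crux SwapGap,
ledger item stmt-AtomisticToContinuum-4433, verbatim] DERANDOMISATION GAP: for continuous profiles
there is σ₀ > 0 such that for 0 < σ < σ₀, every classical hs-Euler solution on [0,T), every family
of hard-sphere flows and local Gibbs data whose fields converge at t = 0: for every t < T,
continuous χ and 1-Lipschitz F bounded by 1 of the three χ-tested empirical fields, E_(P_N)
F(fields(Φ_N,t z)) − E_(P_N ⊗ γ^ℕ) F(fields(Λ_N,t(z, ξ))) → 0, Λ the Lambertian flow (inline `let`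
block over `Alexander.freeExitTime` / `incomingPairs`: free flight to the exit time, then the pair's
outgoing relative velocity |g|·normalize(ω̂ + ξ̂_k), ξ_k i.i.d. standard Gaussian = cosine law about
the contact normal). In THIS route it is not attacked directly: it is the conclusion of
RandomFutureTransfer. (why it might fail: Euler is cross-section independent but the two gases
differ at Navier–Stokes order with rate × influence = O(1) per collision; if mesoscopic texture or a
slow kinetic mode makes the O(Kn) viscous-order difference accumulate coherently before the first
shock, the gap stays O(1).) [MischlerMouhot2012, Chatterjee2006, OllaVaradhanYau1993,
doi:10.3934/krm.2018008, doi:10.1007/s10955-024-03353-1]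
#2 SlabMomentumClosure (crux) — [card item [I], momentum part] For all continuous profiles a₀, θ₀ >
0, u₀ there is σ₀ > 0 such that for σ ∈ (0, σ₀), every classical hs-Euler solution on [0,T) tied to
the data by the LLN at t = 0, every family of hard-sphere flows, every admissible mesoscopic kernel
family φ_N (continuous probability densities on 𝕋³, 0 ≤ φ_N ≤ C ℓ_N⁻³, supported in the ℓ_N-ball,
ℓ_N → 0, ℓ_N (N+1)^(1/3) → ∞), every smooth χ and T' < T: ∀ ε > 0 ∃ τ₀ ∀ τ ≥ τ₀, eventually in N,
for all s ∈ [0,T']: E | m_χ(z(s+Δ)) − m_χ(z(s)) − Δ ∫ ((u_ℓ·∇χ) m_ℓ + p(ρ_ℓ, θ_ℓ) ∇χ) dx | ≤ ε Δ,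
where Δ = τ (N+1)^(-1/3), z(·) the deterministic trajectory from z ~ localGibbsLaw, (ρ_ℓ, m_ℓ, e_ℓ)
the φ_N-block fields of z(s), u_ℓ = m_ℓ/ρ_ℓ, θ_ℓ = (2/3)(e_ℓ/ρ_ℓ − |u_ℓ|²/2), p = hsPressure σ ρ_ℓ
θ_ℓ (outer expectation as a lintegral; empty blocks give flux 0, no junk). [difficulty:
open-problem] (why it might fail: It is deterministic relaxation to local equilibrium in mean from
the flow's own time-s states (Spohn's open 'propagation of local equilibrium'): ring events at O(σ³)
per mean free time or persistent contact correlations could bias the slab-averaged collisional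
transfer away from ρθ(Z−1)𝟙.) [Spohn1991, OllaVaradhanYau1993, KipnisLandim1999]
#3 SlabEnergyClosure (crux) — [card item [I], energy part] Same setting; the increment of the
empirical ENERGY field tested against χ over the slab equals Δ ∫ (e_ℓ + p(ρ_ℓ, θ_ℓ)) (u_ℓ·∇χ) dx in
L¹ of the law, uniformly in s ≤ T', relative error → 0 as τ → ∞ after N → ∞ (energy current (E + p)u
of the hs-Euler system; carries cubic velocity moments and the collisional energy transfer). [deps:
SlabMomentumClosure] [difficulty: open-problem] (why it might fail: Crux 2 plus large velocities:
the energy current carries |v|²v and collisional energy transfer, so the L¹ closure needs uniform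
control of cubic velocity moments along the deterministic non-equilibrium law (the
HighMomentumCutoff input OVY could not supply) and can fail even if momentum closes.) [Spohn1991,
OllaVaradhanYau1993, NachtergaeleYau2003]
#4 RandomFutureTransfer (crux) — [card items [S] + telescoping; the card's bet] Deterministic slab
closure in mean suffices for derandomisation: SlabMomentumClosure → SlabEnergyClosure → SwapGap.
Intended proof: Lindeberg–Trotter time-slab hybrids H_k = Φ on [0,s_k], Λ on (s_k,t], telescoping
over K = t(N+1)^(1/3)/τ slabs, E_Φ F − E_Λ F = Σ_k E_(f_s_k)[Ψ_k(det-slab z) − E_ξ Ψ_k(rand-slab z)]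
with Ψ_k the Λ-value function; per slab the CONSERVED channel is closed by cruxes 2–3 plus slab
relaxation of Λ (second-order Taylor of Ψ_k in finitely many block-field directions, an ε-net over
the z-dependent test functions DΨ_k(B(z))), the NON-CONSERVED channel by KINETIC SCREENING [S] in Λ
(Ψ_k Lipschitz O(1) in block conserved fields in a weak norm, O(Kn) in everything else, uniformly
over reachable states): total ≤ C t δ(τ) + C t/τ → 0 as τ → ∞ after N → ∞. [deps:
SlabMomentumClosure, SlabEnergyClosure, SwapGap] [difficulty: XL] (why it might fail: Needs kinetic
screening POINTWISE in the microstate: a quantitative Euler limit of HS(0) from arbitrary reachable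
states, O(1)-Lipschitz in block fields in a weak norm (stronger than OVY), plus macro-ergodicity of
HS(0); a slow non-hydrodynamic mode of HS(0) or mesoscopic texture breaks it.) [Chatterjee2006,
MischlerMouhot2012, OllaVaradhanYau1993, FritzFunakiLebowitz1994, LiveraniOlla1996]
#5 LambertianEuler (crux) — [shared = route SpecularLambertianSwap's crux LambertianEuler, ledger
item stmt-AtomisticToContinuum-4434, verbatim; = card crux 3 'EulerHS0' = angular-noise-ladder's
random-model target at p = 0] EULER FOR THE LAMBERTIAN GAS: same quantifiers as the conjunct; under
P_N ⊗ γ^ℕ the χ-tested empirical density, momentum and energy fields of Λ_N,t converge in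
probability to ∫χρ_t, ∫χρ_t u_t, ∫χE_t for every t < T. Expected proof: OVY relative entropy method
with the conservative angular collision noise supplying the ergodic decomposition; same EOS (Gibbs
laws are Λ-invariant). [difficulty: open-problem] (why it might fail: True kinetic energy |v|²/2
(HighMomentumCutoff: OVY needed a bounded-gradient kinetic energy for the cubic energy-current
bounds), and the ergodic theorem must come from noise acting ONLY on collision angles with
deterministic partner selection (degenerate noise).) [OllaVaradhanYau1993, FritzFunakiLebowitz1994,
LiveraniOlla1996, Rezakhanlou2003]
#9 IdealGasNoHydro (support) — [card support S3, the σ = 0 oracle; negative-side unit test of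
flows/laws/fields] The ideal gas fails the conjunct's conclusion: ¬ HydrodynamicLimitFor 0. Witness:
a₀ ≡ 1, θ₀ ≡ 1, u₀ = U(x₂)e₁ with U(y) = sin 2πy; (1, u₀, 1) is a global stationary classical
solution of the σ = 0 (ideal-gas EOS, p = ρθ) Euler system; the diameter-0 local Gibbs law is the
product law (hardSphereDomain at ε = 0 is everything, contact = coincidence); free flight with good
set 'no coincidences ever' is a HardSphereFlow at ε = 0 (coincidences are Liouville-null;
measurePreserving_freeFlight_torusGeometry); by the LLN for i.i.d. free particles the momentum field
tested against χ(x) = sin 2πx₂ converges in probability at t = 1 to e^(−2π²)/2 ≠ 1/2 = the Euler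
value. [difficulty: provable-now] [Spohn1991,
Literature.Barriers.AtomisticToContinuum.BoltzmannHypothesisBarrier]

TWO-LAYER PLAN. Foreseen glued splits (nothing filed as children now): RandomFutureTransfer ⇐
KineticScreeningLambertian → SlabRelaxationLambertian →
TelescopingLemma → RandomFutureTransfer (k = 3; glue = the Lindeberg telescoping bookkeeping: strong
Markov property of Λ at slab times,
flow property of Φ, second-order Taylor of the Λ-value function in finitely many block-field
directions, an ε-net over the z-dependent test
functions DΨ(B(z))), to be filed by `route edit --split` once the informal crux
KineticScreeningLambertian (rank 6, filed right after open)
is typed — short signatures need the named Lambertian API requested by SpecularLambertianSwap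
(LambertianHardSphereFlow definitions). SlabMomentumClosure ⇐ KineticStressClosure (one-particle
two-scale
Maxwellianity in mean) → ContactChaosInMean (Enskog factorisation of slab-averaged contact
statistics in mean) → SlabMomentumClosure (k = 2),
once a collision-functional API exists. SlabEnergyClosure ⇐ SlabMomentumClosure-type closure of the
third moments → CubicMomentTails (uniform
integrability of |v|³ along the deterministic law) → SlabEnergyClosure.

KILL CRITERIA. A refutation of SlabMomentumClosure (some smooth pre-shock data, some admissible
scale ℓ_N, a slab-averaged flux differing from the LE flux in
mean at leading order) closes the route outright (`close --reason refuted:SlabMomentumClosure`) and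
is strong evidence for ¬HydrodynamicLimitFor σ
— hand the witness to the negatives index and to DissipativeWeakStrong (its FluxClosure dies with
it). A refutation of SlabEnergyClosure alone
(tails) forces a pivot to a truncated-energy variant of the transfer (momentum + density only cannot
give the conjunct; the route would then
wait for HighMomentumCutoff-type input from apriori-tails-and-rattlers). RandomFutureTransfer is
implied by SwapGap, so it dies only with SwapGap (an N-independent
HS(1)–Λ gap, which breaks BOTH random-future routes); it is ABANDONED (route closed
`exhausted`/`superseded`) if (i) the MD test below shows an N-independent HS(1)–HS(0) gap, or
(ii) kinetic screening [S] is shown false for HS(0) (a slow non-hydrodynamic mode of the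
random-scattering gas), or (iii) route
SpecularLambertianSwap proves SwapGap by its ContactNormalEquidistribution/linear-response
allocation first (then `superseded --by`
that route; cruxes 2–3 survive as items wanted by DissipativeWeakStrong-type lines).
HydrodynamicLimit proved elsewhere moots everything.

NOT DECOMPOSED YET. The stochastic gas is typed INLINE (the `let` block of SwapGap/LambertianEuler,
shared verbatim with route
SpecularLambertianSwap; the card's 'Haar on the separating hemisphere' is replaced by that route's
cosine law — immaterial for the
mechanism: both conserve pair momentum/energy and leave Liouville ⊗ Maxwell invariant); a NAMED
Lambertian API is that route's definition
request and is not re-filed here. Kinetic screening [S] is the informal rank-6 crux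
KineticScreeningLambertian (filed after open, no
signature until the named API lands), and the telescoping glue is not filed. Constants: the
block-scale window is the whole mesoscopic range
(any Kn ≪ ℓ_N ≪ 1) and the slab clock is τ(N+1)^(-1/3) (τ counts mean free times up to the factor
√2πσ²v̄); no rate δ(τ) is prescribed. The
density channel is omitted on purpose (d/dt ρ_χ = m_(∇χ) holds exactly along free flight +
collisions). Velocity tails, the EOS regularity
making the flux integrand bounded (HsEosLowDensity, item 0768 of RelEntropyErgodic), and the N = 2
unit test of the hybrid identity
(SpecularLambertianSwap's support SwapIdentity) are layer-2 / support material for provers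
(`--supports`).

CHEAPEST FALSIFIER. Event-driven MD, φ = 0.05–0.2, N = 10³–10⁵, identical local-Gibbs samples
(sinusoidal shear + temperature wave): (i) run HS(1) and HS(0)
(randomise the outgoing relative direction on the separating hemisphere at each contact) and measure
the gap of the low Fourier modes of
momentum/energy at t = 1 versus N — it must decay like Kn = N^(-1/3); an N-independent gap kills
RandomFutureTransfer's mechanism; (ii) for
crux 2 directly: measure the slab-averaged momentum flux through mesoscopic blocks in HS(1) against
(u·∇χ)ρu + ρθZ(ρσ³)∇χ of the measured
block fields — a bias not shrinking with τ kills SlabMomentumClosure; (iii) analytic sanity (done,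
consistent): at σ = 0 both gases are free
flight, [S] is false and the conjunct's conclusion fails (IdealGasNoHydro), so the line correctly
needs collisions. kit was not run in this
one-shot seat (kit_allowed not in payload).

NUMBERS. Kn = mean free path ≍ (N+1)^(-1/3)/(√2πσ²) at reduced density σ (fixed, (N+1)ε³ = σ³);
collisions per particle per unit time ≍ σ²(N+1)^(1/3);
slab Δ = τ(N+1)^(-1/3), K = t/Δ slabs; screened channel per slab O(Kn)·O(1) ⇒ total O(t/τ);
conserved channel per slab ≤ Δ·δ(τ) ⇒ total
t·δ(τ); collisional momentum transfer per unit time O(σ³) relative to the kinetic stress (excess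
pressure ρθ(Z−1), Z − 1 = (2π/3)ρσ³ + O((ρσ³)²),
LebowitzPenrose1964 / Ruelle1969 §3.4). Items at open: 7 (target SwapGap and crux LambertianEuler
shared with SpecularLambertianSwap; 4 cruxes typed) + 1 informal crux filed right after open.

DEFINITION REQUESTS. - None filed by this route. The named Lambertian hard-sphere API (`lambertDir`,
`lambertPair`, `lambertStep`, `lambertFlow`, `lambertNoise`, …
  — verbatim the `let` block of SwapGap) is route SpecularLambertianSwap's definition request (topic
Summits/AtomisticToContinuum/
  HydrodynamicLimit/Theorems); when it lands, SwapGap/LambertianEuler are restated with short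
signatures in BOTH routes and
  KineticScreeningLambertian becomes typable (block fields as in cruxes 2–3 + the Λ value function).
- (cite fact wanted later, not filed now) an OVY-type Euler limit with conservative collision noise
at fixed density, if LambertianEuler is
  proved outside the tree first.

Novelty: Searches (2026-08-15): `lit search --hybrid "Lindeberg replacement principle Markov semigroup
comparison hydrodynamic limit"` (10 generic
hits: book:kipnis1999 pp. 140–143 one/two-block estimates, book:de-masi1991, book:goldstein1985 pp.
217–235 Trotter/Chernoff product formulas —
no gas-vs-gas Lindeberg scheme); `lit search --hybrid "random scattering direction collisions hard
spheres stochastic dynamics hydrodynamic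
limit Euler"` (10 hits: CIP1994, Saint-Raymond 2009, Gaspard 2022 — kinetic/BG regime only); `lit
vsearch "<slab momentum flux equals local
equilibrium Euler flux of coarse-grained fields in mean …>"` (Evans–Morriss 2008 p. 83
Irving–Kirkwood stress, lattice-gas texts — the
closure is textbook physics, no theorem); `lit frontier AtomisticToContinuum --since 2020` (30 rows;
nearest: arXiv:2310.13338
Canestrari–Liverani–Olla, heat equation from a deterministic dynamics with internal chaotic degrees
of freedom — diffusive, different
mechanism); `lit bridges AtomisticToContinuum --cross any` (30 rows, nothing on comparison of
collision laws); `lit search --source crossref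
"Lindeberg principle Markov semigroup comparison interacting particle system"` (8 irrelevant);
OpenAlex/arXiv/S2 rate-limited (429) and
`lit galaxy search … --star all` saturated at filing (substring probes returned noise) — recorded in
NOTES.md; the card's refuter audit
(2026-08-15T06:37Z) had already searched Chatterjee2006, MischlerMouhot2012, OVY93,
Matthies–Stone–Theil doi:10.3934/krm.2018008  [refs: 10.3934/krm.2018008, 10.1007/s10955-024-03353-1, 2310.13338, book:kipnis1999, book:de-masi1991, book:goldstein1985, doi:10.3934/krm.2018008, doi:10.1007/s10955-024-03353-1, CIP1994, Chatterjee2006, MischlerMouhot2012]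

Barriers (technique_class: lindeberg-swap, comparison-dynamics, flux-closure): - technique_class: lindeberg-swap, comparison-dynamics, flux-closure
- Literature.Barriers.AtomisticToContinuum.BoltzmannHypothesisBarrier: no stationary state of the
deterministic infinite-volume dynamics is classified — HS(1) is asked only for finite-window slab
closure in mean (cruxes 2–3); the ergodic input is consumed for HS(0) only, where conservative
collision noise supplies it (the barrier's own evasion (i), FFL/Liverani–Olla class); the ideal-gas
kernel is respected and typed (IdealGasNoHydro: at σ = 0 both gases are free flight and fail).
- Literature.Barriers.AtomisticToContinuum.MacroErgodicityBarrier: same slot — macro-ergodicity is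
invoked only for the random-scattering gas, at Euler scale with noise present at every collision;
its diffusive/sector-condition clauses are not met.
- Literature.Barriers.AtomisticToContinuum.HighMomentumCutoffBarrier: it does not evade it; the bet
is that the cubic-moment/tail input is isolated in ONE crux (SlabEnergyClosure, rank 3) stated in
L¹-mean along the deterministic law, and that for HS(0) Povzner-type moment propagation is easier
(angular averaging built into the dynamics); shared with apriori-tails-and-rattlers.
- Literature.Barriers.AtomisticToContinuum.VelocityReversalBarrier: not met — every statement is
law-level (L¹ of the local Gibbs law, convergence in probability); the hybrid order (deterministic
past, random future) is time-asymmetric by design, as the barrier requires.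
- Literature.Barriers.AtomisticToContinuum.

Novelty grade: new-combination — REVIEW rreview-7b9376c7 2026-08-15 (route retired by operator 13:45:47Z, D-0027 §2.1 syntactic: Assembly must conclude _root_.HydrodynamicLimit — findings hold for the conforming re-file). VERDICT: SOUND, no blocking objection; not a recombination of closed routes (shares 4433/4434 with open Specula (refuter refuter-rreview-route-AtomisticToContinu-7b9376c7-0, 2026-08-15T13:48:10Z; prior: Chatterjee2006; MischlerMouhot2012; OllaVaradhanYau1993; FritzFunakiLebowitz1994; LiveraniOlla1996; Spohn1991)

History (route lifecycle, newest last):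
- 2026-08-15T13:45:47Z · CLOSED retired — not-a-thesis: assembly does not conclude the sub-problem Statement (operator:999:1257524)

sub-problem: HydrodynamicLimit · status: closed(retired) · opened planner-plancard-AtomisticToContinuum-Hydrody-e3988534-0 2026-08-15T11:45:01Z · rev 1 · ledger route-AtomisticToContinuum-RandomFutureLindeberg
GENERATED by the gate from the ledger (D-0016/17). Provers cite these decls: `theorem foo : Summit.AtomisticToContinuum.HydrodynamicLimit.Theses.RandomFutureLindeberg.<Decl> := …` in Summits/AtomisticToContinuum/HydrodynamicLimit/Theorems/<Name>.lean.
-/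

namespace Summit.AtomisticToContinuum.HydrodynamicLimit.Theses.RandomFutureLindeberg

open scoped BigOperators Topology Manifold Classical MeasureTheory ProbabilityTheory Matrix InnerProductSpace ComplexConjugate ContinuousMap
open Filter Set Function TopologicalSpace MeasureTheory

attribute [summit_statement] _root_.HydrodynamicLimit

/-- item stmt-AtomisticToContinuum-4433 · target · rank 0 · closed · moot by None · by planner
why it might fail: Euler is cross-section independent but the two gases differ at Navier–Stokes order with rate × influence = O(1) per collision; if mesoscopic texture or a slow kinetic mode makes the O(Kn) viscous-order difference accumulate coherently before the first shock, the gap stays O(1).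
sources: MischlerMouhot2012, Chatterjee2006, OllaVaradhanYau1993, doi:10.3934/krm.2018008, doi:10.1007/s10955-024-03353-1
[crux] DERANDOMISATION GAP (card A1∧A2∧A4 + Volterra–Gronwall, layer-1 form). For continuous
profiles a₀, θ₀ > 0, u₀ there is σ₀ > 0 such that for 0 < σ < σ₀, every classical hs-Euler solution
on [0,T), every family of hard-sphere flows Φ_N and local Gibbs data whose fields converge at t = 0:
for every t < T, continuous χ and every 1-Lipschitz F : ℝ × ℝ³ × ℝ → [−1,1] of the three χ-tested
empirical fields, E_(P_N) F(fields(Φ_N,t z)) − E_(P_N ⊗ γ^ℕ) F(fields(Λ_N,t(z, ξ))) → 0, where Λ =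
lflow is the Lambertian flow, written as an inline `let` block shared verbatim by the items: Cfg N =
(N+1)-sphere phase space over 𝕋³, G = torus geometry, ε σ N = hsDiameter, τ =
`Alexander.freeExitTime`, S = free flight, ldir ω ξ = normalize(ω̂+ξ̂) (cosine law about ω̂ when ξ
is standard Gaussian), lpair = momentum/energy-conserving redraw of the pair (i,j) along ldir, lstep
= free flight to the exit time then lpair on the incoming contact pair (`Alexander.incomingPairs`;
identity if τ = ∞) — i.e. the library's `collisionStep` with `collidePair` replaced by the
Lambertian redraw —, lstate/linst/lflow = its iteration driven by ξ_k, collision instants and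
right-continuous flow exactly as `Alexander.st -/
@[route_item "route-AtomisticToContinuum-RandomFutureLindeberg"]
def SwapGap : Prop :=
  let Cfg : ℕ → Type := fun N => Literature.Analysis.FluidPDE.Config (N + 1) (Fin 3) (UnitAddTorus (Fin 3)); let G := Literature.Analysis.FluidPDE.Torus.geometry (Fin 3); let ε : ℝ → ℕ → ℝ := Literature.MathematicalPhysics.KineticTheory.hsDiameter; let τ : ℝ → (N : ℕ) → Cfg N → ENNReal := fun σ N z => Literature.Analysis.FluidPDE.Alexander.freeExitTime G (ε σ N) z; let S : ℝ → (N : ℕ) → Cfg N → Cfg N := fun t _ z => Literature.Analysis.FluidPDE.freeFlight G t z; let ldir : EuclideanSpace ℝ (Fin 3) → EuclideanSpace ℝ (Fin 3) → EuclideanSpace ℝ (Fin 3) := fun ω ξ => ‖‖ω‖⁻¹ • ω + ‖ξ‖⁻¹ • ξ‖⁻¹ • (‖ω‖⁻¹ • ω + ‖ξ‖⁻¹ • ξ); let lpair : (N : ℕ) → Fin (N + 1) → Fin (N + 1) → Cfg N → EuclideanSpace ℝ (Fin 3) → Cfg N := fun _ i j z ξ => let c := (2 : ℝ)⁻¹ •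 ((z i).2 + (z j).2); let w := (‖(z i).2 - (z j).2‖ / 2) • ldir (G.sepVec (z i).1 (z j).1) ξ; Function.update (Function.update z i ((z i).1, c + w)) j ((z j).1, c - w); let lstep : ℝ → (N : ℕ) → EuclideanSpace ℝ (Fin 3) → Cfg N → Cfg N := fun σ N ξ z => let z' := S (τ σ N z).toReal N z; if τ σ N z = ⊤ then z else if h : (Literature.Analysis.FluidPDE.Alexander.incomingPairs G (ε σ N) z').Nonempty then lpair N h.some.1 h.some.2 z' ξ else z'; let lstate : ℝ → (N : ℕ) → (ℕ → EuclideanSpace ℝ (Fin 3)) → Cfg N → ℕ → Cfg N := fun σ N ξs z k => ((fun p : Cfg N × ℕ => (lstep σ N (ξs p.2) p.1, p.2 + 1))^[k] (z, 0)).1; let linst : ℝ → (N : ℕ) → (ℕ → EuclideanSpace ℝ (Fin 3)) → Cfg N → ℕ → ENNReal := fun σ N ξs z k => ∑ m ∈ Finset.range k, τ σ N (lstate σ N ξs z m); let lflow : ℝ → (N : ℕ) → (ℕ → EuclideanSpace ℝ (Fin 3)) → Cfg N → ℝ → Cfg N := fun σ N ξs z t => let K := sSup {k : ℕ | linst σ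 N ξs z k ≤ ENNReal.ofReal t}; S (t - (linst σ N ξs z K).toReal) N (lstate σ N ξs z K); let noise : MeasureTheory.Measure (ℕ → EuclideanSpace ℝ (Fin 3)) := MeasureTheory.Measure.infinitePi (fun _ : ℕ => ProbabilityTheory.stdGaussian (EuclideanSpace ℝ (Fin 3))); let fld : (N : ℕ) → Cfg N → ((UnitAddTorus (Fin 3)) → ℝ) → ℝ × (EuclideanSpace ℝ (Fin 3)) × ℝ := fun _ z χ => (Literature.MathematicalPhysics.KineticTheory.empiricalDensityField z χ, Literature.MathematicalPhysics.KineticTheory.empiricalMomentumField z χ, Literature.MathematicalPhysics.KineticTheory.empiricalEnergyField z χ); ∀ (a₀ θ₀ : (UnitAddTorus (Fin 3)) → ℝ) (u₀ : (UnitAddTorus (Fin 3)) → EuclideanSpace ℝ (Fin 3)), Continuous a₀ → Continuous θ₀ → Continuous u₀ → (∀ x, 0 < a₀ x) → (∀ x, 0 < θ₀ x) → ∃ σ₀ : ℝ, 0 < σ₀ ∧ ∀ σ : ℝ, 0 < σ → σ < σ₀ → ∀ (T : ℝ) (ρ θ : ℝ → (UnitAddTorus (Fin 3)) → ℝ) (u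 : ℝ → (UnitAddTorus (Fin 3)) → EuclideanSpace ℝ (Fin 3)), Literature.MathematicalPhysics.KineticTheory.IsHardSphereEulerSolution σ T ρ u θ → ∀ Φ : (N : ℕ) → Literature.Analysis.FluidPDE.HardSphereFlow G (ε σ N) (N + 1), let P := fun N => Literature.MathematicalPhysics.KineticTheory.localGibbsLaw σ a₀ u₀ θ₀ N (Φ N); Literature.MathematicalPhysics.KineticTheory.TendstoHydroFieldsAt P Φ ρ u θ 0 → ∀ t ∈ Set.Ico 0 T, ∀ χ : (UnitAddTorus (Fin 3)) → ℝ, Continuous χ → ∀ F : ℝ × (EuclideanSpace ℝ (Fin 3)) × ℝ → ℝ, LipschitzWith 1 F → (∀ y, |F y| ≤ 1) → Filter.Tendsto (fun N : ℕ => (∫ z, F (fld N ((Φ N).flow t z) χ) ∂(P N)) - ∫ p, F (fld N (lflow σ N p.2 p.1 t) χ) ∂((P N).prod noise)) Filter.atTop (nhds 0)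

/-- item stmt-AtomisticToContinuum-6194 · crux · rank 2 · closed · moot by None · by planner
why it might fail: It is deterministic relaxation to local equilibrium in mean from the flow's own time-s states (Spohn's open 'propagation of local equilibrium'): ring events at O(σ³) per mean free time or persistent contact correlations could bias the slab-averaged collisional transfer away from ρθ(Z−1)𝟙.
sources: Spohn1991, OllaVaradhanYau1993, KipnisLandim1999
[crux] [card item [I], momentum part] For all continuous profiles a₀, θ₀ > 0, u₀ there is σ₀ > 0
such that for σ ∈ (0, σ₀), every classical hs-Euler solution on [0,T) tied to the data by the LLN at
t = 0, every family of hard-sphere flows, every admissible mesoscopic kernel family φ_N (continuous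
probability densities on 𝕋³, 0 ≤ φ_N ≤ C ℓ_N⁻³, supported in the ℓ_N-ball, ℓ_N → 0, ℓ_N (N+1)^(1/3)
→ ∞), every smooth χ and T' < T: ∀ ε > 0 ∃ τ₀ ∀ τ ≥ τ₀, eventually in N, for all s ∈ [0,T']: E |
m_χ(z(s+Δ)) − m_χ(z(s)) − Δ ∫ ((u_ℓ·∇χ) m_ℓ + p(ρ_ℓ, θ_ℓ) ∇χ) dx | ≤ ε Δ, where Δ = τ (N+1)^(-1/3),
z(·) the deterministic trajectory from z ~ localGibbsLaw, (ρ_ℓ, m_ℓ, e_ℓ) the φ_N-block fields of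
z(s), u_ℓ = m_ℓ/ρ_ℓ, θ_ℓ = (2/3)(e_ℓ/ρ_ℓ − |u_ℓ|²/2), p = hsPressure σ ρ_ℓ θ_ℓ (outer expectation as
a lintegral; empty blocks give flux 0, no junk). [difficulty: open-problem] -/
@[route_item "route-AtomisticToContinuum-RandomFutureLindeberg"]
def SlabMomentumClosure : Prop :=
  ∀ (a₀ θ₀ : Literature.MathematicalPhysics.KineticTheory.T3 → ℝ) (u₀ : Literature.MathematicalPhysics.KineticTheory.T3 → Literature.MathematicalPhysics.KineticTheory.V3), Continuous a₀ → Continuous θ₀ → Continuous u₀ → (∀ x, 0 < a₀ x) → (∀ x, 0 < θ₀ x) → ∃ σ₀ : ℝ, 0 < σ₀ ∧ ∀ σ : ℝ, 0 < σ → σ < σ₀ → ∀ (T : ℝ) (ρ θ : ℝ → Literature.MathematicalPhysics.KineticTheory.T3 → ℝ) (u : ℝ → Literature.MathematicalPhysics.KineticTheory.T3 → Literature.MathematicalPhysics.KineticTheory.V3), Literature.MathematicalPhysics.KineticTheory.IsHardSphereEulerSolution σ T ρ u θ → ∀ Φ : (N : ℕ) → Literature.Analysis.FluidPDE.HardSphereFlow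 (Literature.Analysis.FluidPDE.Torus.geometry (Fin 3)) (Literature.MathematicalPhysics.KineticTheory.hsDiameter σ N) (N + 1), Literature.MathematicalPhysics.KineticTheory.TendstoHydroFieldsAt (fun N => Literature.MathematicalPhysics.KineticTheory.localGibbsLaw σ a₀ u₀ θ₀ N (Φ N)) Φ ρ u θ 0 → ∀ (φ : ℕ → Literature.MathematicalPhysics.KineticTheory.T3 → ℝ) (ℓ : ℕ → ℝ) (C : ℝ), (∀ N, Continuous (φ N)) → (∀ N x, 0 ≤ φ N x) → (∀ N, ∫ x, φ N x = 1) → (∀ N x, φ N x ≤ C * (ℓ N)⁻¹ ^ 3) → (∀ N x, ℓ N < Literature.Analysis.FluidPDE.Torus.euclidDist x 0 → φ N x = 0) → Filter.Tendsto ℓ Filter.atTop (nhds 0) → Filter.Tendsto (fun N => ℓ N * ((N + 1 : ℕ) : ℝ) ^ (1 / 3 : ℝ)) Filter.atTop Filter.atTop → ∀ χ : Literature.MathematicalPhysics.KineticTheory.T3 → ℝ, Literature.Analysis.FunctionSpaces.Torus.IsSmooth χ → ∀ T' ∈ Set.Ico 0 T, ∀ e : ℝ, 0 < e → ∃ τ₀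 : ℝ, ∀ τ : ℝ, τ₀ ≤ τ → ∀ᶠ N : ℕ in Filter.atTop, ∀ s ∈ Set.Icc 0 T', ∫⁻ z, (let Δ : ℝ := (τ * ((N + 1 : ℕ) : ℝ) ^ (-(1 / 3 : ℝ))); let w := (Φ N).flow s z; let R : Literature.MathematicalPhysics.KineticTheory.T3 → ℝ := fun x => Literature.MathematicalPhysics.KineticTheory.empiricalDensityField w (fun y => φ N (x - y)); let M : Literature.MathematicalPhysics.KineticTheory.T3 → Literature.MathematicalPhysics.KineticTheory.V3 := fun x => Literature.MathematicalPhysics.KineticTheory.empiricalMomentumField w (fun y => φ N (x - y)); let E : Literature.MathematicalPhysics.KineticTheory.T3 → ℝ := fun x => Literature.MathematicalPhysics.KineticTheory.empiricalEnergyField w (fun y => φ N (x - y)); let U : Literature.MathematicalPhysics.KineticTheory.T3 → Literature.MathematicalPhysics.KineticTheory.V3 := fun x => (R x)⁻¹ • M x; let Θ : Literature.MathematicalPhysics.KineticTheory.T3 → ℝ := fun x => 2 / 3 * (E x / R x - ‖U x‖ ^ 2 / 2); ENNReal.ofReal ‖Literature.MathematicalPhysics.KineticTheory.empiricalMomentumField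 ((Φ N).flow (s + Δ) z) χ - Literature.MathematicalPhysics.KineticTheory.empiricalMomentumField w χ - Δ • ∫ x, (inner ℝ (U x) (Literature.Analysis.FunctionSpaces.Torus.gradient χ x) • M x + Literature.MathematicalPhysics.KineticTheory.hsPressure σ (R x) (Θ x) • Literature.Analysis.FunctionSpaces.Torus.gradient χ x)‖) ∂(Literature.MathematicalPhysics.KineticTheory.localGibbsLaw σ a₀ u₀ θ₀ N (Φ N)) ≤ ENNReal.ofReal (e * (τ * ((N + 1 : ℕ) : ℝ) ^ (-(1 / 3 : ℝ))))

/-- item stmt-AtomisticToContinuum-6195 · crux · rank 3 · closed · moot by None · by planner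
why it might fail: Crux 2 plus large velocities: the energy current carries |v|²v and collisional energy transfer, so the L¹ closure needs uniform control of cubic velocity moments along the deterministic non-equilibrium law (the HighMomentumCutoff input OVY could not supply) and can fail even if momentum closes.
sources: Spohn1991, OllaVaradhanYau1993, NachtergaeleYau2003
[crux] [card item [I], energy part] Same setting; the increment of the empirical ENERGY field tested
against χ over the slab equals Δ ∫ (e_ℓ + p(ρ_ℓ, θ_ℓ)) (u_ℓ·∇χ) dx in L¹ of the law, uniformly in s
≤ T', relative error → 0 as τ → ∞ after N → ∞ (energy current (E + p)u of the hs-Euler system;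
carries cubic velocity moments and the collisional energy transfer). [deps: SlabMomentumClosure]
[difficulty: open-problem] -/
@[route_item "route-AtomisticToContinuum-RandomFutureLindeberg"]
def SlabEnergyClosure : Prop :=
  ∀ (a₀ θ₀ : Literature.MathematicalPhysics.KineticTheory.T3 → ℝ) (u₀ : Literature.MathematicalPhysics.KineticTheory.T3 → Literature.MathematicalPhysics.KineticTheory.V3), Continuous a₀ → Continuous θ₀ → Continuous u₀ → (∀ x, 0 < a₀ x) → (∀ x, 0 < θ₀ x) → ∃ σ₀ : ℝ, 0 < σ₀ ∧ ∀ σ : ℝ, 0 < σ → σ < σ₀ → ∀ (T : ℝ) (ρ θ : ℝ → Literature.MathematicalPhysics.KineticTheory.T3 → ℝ) (u : ℝ → Literature.MathematicalPhysics.KineticTheory.T3 → Literature.MathematicalPhysics.KineticTheory.V3), Literature.MathematicalPhysics.KineticTheory.IsHardSphereEulerSolution σ T ρ u θ → ∀ Φ : (N : ℕ) → Literature.Analysis.FluidPDE.HardSphereFlow (Literature.Analysis.FluidPDE.Torus.geometry (Fin 3)) (Literature.MathematicalPhysics.KineticTheory.hsDiameter σ N) (N + 1), Literature.MathematicalPhysics.KineticTheory.TendstoHydroFieldsAt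 (fun N => Literature.MathematicalPhysics.KineticTheory.localGibbsLaw σ a₀ u₀ θ₀ N (Φ N)) Φ ρ u θ 0 → ∀ (φ : ℕ → Literature.MathematicalPhysics.KineticTheory.T3 → ℝ) (ℓ : ℕ → ℝ) (C : ℝ), (∀ N, Continuous (φ N)) → (∀ N x, 0 ≤ φ N x) → (∀ N, ∫ x, φ N x = 1) → (∀ N x, φ N x ≤ C * (ℓ N)⁻¹ ^ 3) → (∀ N x, ℓ N < Literature.Analysis.FluidPDE.Torus.euclidDist x 0 → φ N x = 0) → Filter.Tendsto ℓ Filter.atTop (nhds 0) → Filter.Tendsto (fun N => ℓ N * ((N + 1 : ℕ) : ℝ) ^ (1 / 3 : ℝ)) Filter.atTop Filter.atTop → ∀ χ : Literature.MathematicalPhysics.KineticTheory.T3 → ℝ, Literature.Analysis.FunctionSpaces.Torus.IsSmooth χ → ∀ T' ∈ Set.Ico 0 T, ∀ e : ℝ, 0 < e → ∃ τ₀ : ℝ, ∀ τ : ℝ, τ₀ ≤ τ → ∀ᶠ N : ℕ in Filter.atTop, ∀ s ∈ Set.Icc 0 T', ∫⁻ z, (let Δ : ℝ := (τ * ((N +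 1 : ℕ) : ℝ) ^ (-(1 / 3 : ℝ))); let w := (Φ N).flow s z; let R : Literature.MathematicalPhysics.KineticTheory.T3 → ℝ := fun x => Literature.MathematicalPhysics.KineticTheory.empiricalDensityField w (fun y => φ N (x - y)); let M : Literature.MathematicalPhysics.KineticTheory.T3 → Literature.MathematicalPhysics.KineticTheory.V3 := fun x => Literature.MathematicalPhysics.KineticTheory.empiricalMomentumField w (fun y => φ N (x - y)); let E : Literature.MathematicalPhysics.KineticTheory.T3 → ℝ := fun x => Literature.MathematicalPhysics.KineticTheory.empiricalEnergyField w (fun y => φ N (x - y)); let U : Literature.MathematicalPhysics.KineticTheory.T3 → Literature.MathematicalPhysics.KineticTheory.V3 := fun x => (R x)⁻¹ • M x; let Θ : Literature.MathematicalPhysics.KineticTheory.T3 → ℝ := fun x => 2 / 3 * (E x / R x - ‖U x‖ ^ 2 / 2); ENNReal.ofReal |Literature.MathematicalPhysics.KineticTheory.empiricalEnergyField ((Φ N).flow (s + Δ) z) χ - Literature.MathematicalPhysics.KineticTheory.empiricalEnergyField w χ - Δ * ∫ x, (E x + Literature.MathematicalPhysics.KineticTheory.hsPressure σ (R x) (Θ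 x)) * inner ℝ (U x) (Literature.Analysis.FunctionSpaces.Torus.gradient χ x)|) ∂(Literature.MathematicalPhysics.KineticTheory.localGibbsLaw σ a₀ u₀ θ₀ N (Φ N)) ≤ ENNReal.ofReal (e * (τ * ((N + 1 : ℕ) : ℝ) ^ (-(1 / 3 : ℝ))))

/-- item stmt-AtomisticToContinuum-6196 · crux · rank 4 · closed · moot by None · by planner
why it might fail: Needs kinetic screening POINTWISE in the microstate: a quantitative Euler limit of HS(0) from arbitrary reachable states, O(1)-Lipschitz in block fields in a weak norm (stronger than OVY), plus macro-ergodicity of HS(0); a slow non-hydrodynamic mode of HS(0) or mesoscopic texture breaks it.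
sources: Chatterjee2006, MischlerMouhot2012, OllaVaradhanYau1993, FritzFunakiLebowitz1994, LiveraniOlla1996
[crux] [card items [S] + telescoping; the card's bet] Deterministic slab closure in mean suffices
for derandomisation: SlabMomentumClosure → SlabEnergyClosure → SwapGap. Intended proof:
Lindeberg–Trotter time-slab hybrids H_k = Φ on [0,s_k], Λ on (s_k,t], telescoping over K =
t(N+1)^(1/3)/τ slabs, E_Φ F − E_Λ F = Σ_k E_(f_s_k)[Ψ_k(det-slab z) − E_ξ Ψ_k(rand-slab z)] with Ψ_k
the Λ-value function; per slab the CONSERVED channel is closed by cruxes 2–3 plus slab relaxation of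
Λ (second-order Taylor of Ψ_k in finitely many block-field directions, an ε-net over the z-dependent
test functions DΨ_k(B(z))), the NON-CONSERVED channel by KINETIC SCREENING [S] in Λ (Ψ_k Lipschitz
O(1) in block conserved fields in a weak norm, O(Kn) in everything else, uniformly over reachable
states): total ≤ C t δ(τ) + C t/τ → 0 as τ → ∞ after N → ∞. [deps: SlabMomentumClosure,
SlabEnergyClosure, SwapGap] [difficulty: XL] -/
@[route_item "route-AtomisticToContinuum-RandomFutureLindeberg"]
def RandomFutureTransfer : Prop :=
  SlabMomentumClosure → SlabEnergyClosure → SwapGap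

/-- item stmt-AtomisticToContinuum-4434 · crux · rank 5 · closed · moot by None · by planner
why it might fail: True kinetic energy |v|²/2 (HighMomentumCutoff: OVY needed a bounded-gradient kinetic energy for the cubic energy-current bounds), and the ergodic theorem must come from noise acting ONLY on collision angles with deterministic partner selection (degenerate noise).
sources: OllaVaradhanYau1993, FritzFunakiLebowitz1994, LiveraniOlla1996, Rezakhanlou2003
[crux] EULER FOR THE LAMBERTIAN GAS (card A3 = angular-noise-ladder's random-model target at p = 0 =
lindeberg-random-future-universality crux 3). Same quantifiers as the conjunct; conclusion: under
P_N ⊗ γ^ℕ the χ-tested empirical density, momentum and energy fields of Λ_N,t converge in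
probability to ∫χρ_t, ∫χρ_t u_t, ∫χE_t for every t < T. Expected proof: OVY relative entropy method
with the conservative angular collision noise supplying the ergodic decomposition (stationary
translation-invariant finite-entropy states of the infinite Lambertian gas are mixtures of Gibbs),
same EOS p = ρθZ(ρσ³) (Gibbs laws are Λ-invariant). [difficulty: open-problem] -/
@[route_item "route-AtomisticToContinuum-RandomFutureLindeberg"]
def LambertianEuler : Prop :=
  let Cfg : ℕ → Type := fun N => Literature.Analysis.FluidPDE.Config (N + 1) (Fin 3) (UnitAddTorus (Fin 3)); let G := Literature.Analysis.FluidPDE.Torus.geometry (Fin 3); let ε : ℝ → ℕ → ℝ := Literature.MathematicalPhysics.KineticTheory.hsDiameter; let τ : ℝ → (N : ℕ) → Cfg N → ENNReal := fun σ N z => Literature.Analysis.FluidPDE.Alexander.freeExitTime G (ε σ N) z; let S : ℝ → (N : ℕ) → Cfg N → Cfg N := fun t _ z => Literature.Analysis.FluidPDE.freeFlight G t z; let ldir : EuclideanSpace ℝ (Fin 3) → EuclideanSpace ℝ (Fin 3) → EuclideanSpace ℝ (Fin 3) := fun ω ξ => ‖‖ω‖⁻¹ • ω + ‖ξ‖⁻¹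 • ξ‖⁻¹ • (‖ω‖⁻¹ • ω + ‖ξ‖⁻¹ • ξ); let lpair : (N : ℕ) → Fin (N + 1) → Fin (N + 1) → Cfg N → EuclideanSpace ℝ (Fin 3) → Cfg N := fun _ i j z ξ => let c := (2 : ℝ)⁻¹ • ((z i).2 + (z j).2); let w := (‖(z i).2 - (z j).2‖ / 2) • ldir (G.sepVec (z i).1 (z j).1) ξ; Function.update (Function.update z i ((z i).1, c + w)) j ((z j).1, c - w); let lstep : ℝ → (N : ℕ) → EuclideanSpace ℝ (Fin 3) → Cfg N → Cfg N := fun σ N ξ z => let z' := S (τ σ N z).toReal N z; if τ σ N z = ⊤ then z else if h : (Literature.Analysis.FluidPDE.Alexander.incomingPairs G (ε σ N) z').Nonempty then lpair N h.some.1 h.some.2 z' ξ else z'; let lstate : ℝ → (N : ℕ) → (ℕ → EuclideanSpace ℝ (Fin 3)) → Cfg N → ℕ → Cfg N := fun σ N ξs z k => ((fun p : Cfg N × ℕ => (lstep σ N (ξs p.2) p.1, p.2 + 1))^[k] (z, 0)).1; let linst : ℝ → (N : ℕ) → (ℕ → EuclideanSpace ℝ (Fin 3)) → Cfg N → ℕ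 → ENNReal := fun σ N ξs z k => ∑ m ∈ Finset.range k, τ σ N (lstate σ N ξs z m); let lflow : ℝ → (N : ℕ) → (ℕ → EuclideanSpace ℝ (Fin 3)) → Cfg N → ℝ → Cfg N := fun σ N ξs z t => let K := sSup {k : ℕ | linst σ N ξs z k ≤ ENNReal.ofReal t}; S (t - (linst σ N ξs z K).toReal) N (lstate σ N ξs z K); let noise : MeasureTheory.Measure (ℕ → EuclideanSpace ℝ (Fin 3)) := MeasureTheory.Measure.infinitePi (fun _ : ℕ => ProbabilityTheory.stdGaussian (EuclideanSpace ℝ (Fin 3))); ∀ (a₀ θ₀ : (UnitAddTorus (Fin 3)) → ℝ) (u₀ : (UnitAddTorus (Fin 3)) → EuclideanSpace ℝ (Fin 3)), Continuous a₀ → Continuous θ₀ → Continuous u₀ → (∀ x, 0 < a₀ x) → (∀ x, 0 < θ₀ x) → ∃ σ₀ : ℝ, 0 < σ₀ ∧ ∀ σ : ℝ, 0 < σ → σ < σ₀ → ∀ (T : ℝ) (ρ θ : ℝ → (UnitAddTorus (Fin 3)) → ℝ) (u : ℝ → (UnitAddTorus (Fin 3)) → EuclideanSpace ℝ (Fin 3)),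 Literature.MathematicalPhysics.KineticTheory.IsHardSphereEulerSolution σ T ρ u θ → ∀ Φ : (N : ℕ) → Literature.Analysis.FluidPDE.HardSphereFlow G (ε σ N) (N + 1), let P := fun N => Literature.MathematicalPhysics.KineticTheory.localGibbsLaw σ a₀ u₀ θ₀ N (Φ N); Literature.MathematicalPhysics.KineticTheory.TendstoHydroFieldsAt P Φ ρ u θ 0 → ∀ t ∈ Set.Ico 0 T, ∀ χ : (UnitAddTorus (Fin 3)) → ℝ, Continuous χ → ∀ δ > (0 : ℝ), Filter.Tendsto (fun N : ℕ => ((P N).prod noise) {p | δ < |Literature.MathematicalPhysics.KineticTheory.empiricalDensityField (lflow σ N p.2 p.1 t) χ - ∫ x, χ x * ρ t x|}) Filter.atTop (nhds 0) ∧ Filter.Tendsto (fun N : ℕ => ((P N).prod noise) {p | δ < ‖Literature.MathematicalPhysics.KineticTheory.empiricalMomentumField (lflow σ N p.2 p.1 t) χ - ∫ x, (χ x * ρ t x) • u t x‖}) Filter.atTop (nhds 0) ∧ Filter.Tendsto (fun N : ℕ => ((P N).prod noise) {p | δ < |Literature.MathematicalPhysics.KineticTheory.empiricalEnergyField (lflow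 σ N p.2 p.1 t) χ - ∫ x, χ x * Literature.MathematicalPhysics.KineticTheory.totalEnergyDensity (ρ t x) (u t x) (θ t x)|}) Filter.atTop (nhds 0)

-- item stmt-AtomisticToContinuum-8356 · support · rank 6 · closed · moot by None · by planner — informal only, no Lean statement yet:
--   [crux] KINETIC SCREENING IN THE LAMBERTIAN GAS (card item [S]; the stochastic input of
--   RandomFutureTransfer, its foreseen first child). For 0 < σ < σ₀, a macroscopic horizon t − s ∈ (0,
--   T) pre-shock, a bounded 1-Lipschitz functional F of finitely many χ-tested empirical fields and the
--   Λ-value function Ψ(z') := E_ξ F(fields(Λ_{t−s}(z', ξ))) (Λ = the Lambertian flow of SwapGap's `let`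
--   block): for microstates z', z'' in the class reachable from local Gibbs data (density ≤ e^{cN}
--   w.r.t. a canonical hs-Gibbs law, bounded energy per particle) whose block conserved fields at a
--   mesoscopic scale Kn ≪ ℓ

/-- item stmt-AtomisticToContinuum-6197 · support · rank 9 · closed · moot by None · by planner
sources: Spohn1991, Literature.Barriers.AtomisticToContinuum.BoltzmannHypothesisBarrier
[support] [card support S3, the σ = 0 oracle; negative-side unit test of flows/laws/fields] The
ideal gas fails the conjunct's conclusion: ¬ HydrodynamicLimitFor 0. Witness: a₀ ≡ 1, θ₀ ≡ 1, u₀ =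
U(x₂)e₁ with U(y) = sin 2πy; (1, u₀, 1) is a global stationary classical solution of the σ = 0
(ideal-gas EOS, p = ρθ) Euler system; the diameter-0 local Gibbs law is the product law
(hardSphereDomain at ε = 0 is everything, contact = coincidence); free flight with good set 'no
coincidences ever' is a HardSphereFlow at ε = 0 (coincidences are Liouville-null;
measurePreserving_freeFlight_torusGeometry); by the LLN for i.i.d. free particles the momentum field
tested against χ(x) = sin 2πx₂ converges in probability at t = 1 to e^(−2π²)/2 ≠ 1/2 = the Euler
value. [difficulty: provable-now] -/
@[route_item "route-AtomisticToContinuum-RandomFutureLindeberg"]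
def IdealGasNoHydro : Prop :=
  ¬ Literature.MathematicalPhysics.KineticTheory.HydrodynamicLimitFor 0

/-- item stmt-AtomisticToContinuum-6198 · assembly · rank 1 · closed · moot by None · by planner
sources: Spohn1991, OllaVaradhanYau1993
[assembly] SlabMomentumClosure → SlabEnergyClosure → RandomFutureTransfer → LambertianEuler →
HydrodynamicLimit. -/
@[route_item "route-AtomisticToContinuum-RandomFutureLindeberg"]
def Assembly : Prop :=
  SlabMomentumClosure → SlabEnergyClosure → RandomFutureTransfer → LambertianEuler → Literature.MathematicalPhysics.KineticTheory.HydrodynamicLimit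

end Summit.AtomisticToContinuum.HydrodynamicLimit.Theses.RandomFutureLindeberg
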